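import Summits.BirchSwinnertonDyer.Rank1Residual.Supersingular.RankOneKimLevelKUnitRecordShape
import Summits.BirchSwinnertonDyer.Rank1Residual.Supersingular.X8KimLevelKRankOneOPEN
import Summits.BirchSwinnertonDyer.Rank1Residual.Supersingular.CountPointsFast
import HarnessLib

/-!
# Rank ONE at `p = 3` on the TAM-DEFECT rows (`#Ш_an` a `3`-unit, `t = ord₃ ∏c_ℓ ≥ 1`): what ONE level-`3^k`
# Kurihara number at a prime `ℓ ∈ 𝒫_k`, `k ≤ t + 2`, gives MODULO Kim 2025 (PRE) **and** the `≥` half of Kim's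
# Conjecture 1.10 at the pair (`X4.KimTamagawaDefectGeAt`, TYPED, OPEN) — the class-side SHAPE of n1011-p11's
# own-currency (LK-3)/(LK-4), and its literal-equation RECORD SHAPE (cell `b2b-bsdres`, supersingular family
# prover B = unit `b2b-bsdres-additive-p3`, gen 23; class lead N6·O3, X7 joint B side)

HONEST FRAMING (run/shared/lean/b2b/bsd-rank1-residual/, verbatim in every file): the goal of the
cell is to DELETE the COMBINATION-SHAPED residual classes of the Birch–Swinnerton-Dyer formula for
ALL analytic-rank `≤ 1` elliptic curves over `ℚ` — "full BSD formula for every rank `≤ 1` curve in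
class `C`" assembled STRICTLY from published theorems — so that the rank-`≤ 1` remainder becomes
exactly the CONSTRUCTION-SHAPED classes, which are TYPED (missing-input `Prop`s), NOT attempted.
This is not "finishing BSD". X7 / X8 stay CONSTRUCTION-SHAPED; THEOREMS ONLY (compositions of tree
theorems BY NAME; no definition, no named fact, debt 0); per pair; NOT class theorems; nothing booked;
O3's / O4's marks do not move. EVERY theorem below carries TWO OPEN binders, both displayed:
`hK25s : Kim2025.thm11_kimShaLength_of_integralPeriod_OPEN` (the ANNOUNCED preprint C.-H. Kim (app.
R. Pollack), arXiv:2505.09121 Thm. 1.1 — PRE; its `p = 3` Kolyvagin systems = Sakamoto, JTNB 36 (2024),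
refereed) and `hGe : X4.KimTamagawaDefectGeAt W 3 D.f` (n1011-p12's TYPED `@[conjecture]` predicate
`ord₃ ∏c ≤ ∂^{(∞)}(δ̃)` = the `≥` half of Kim AJM 148 Conj. 1.10 AT THE PAIR — a CONJECTURE, not an
announced theorem: NO published or announced source proves it in analytic rank one at a supersingular
`3`; Büyükboduk's Tamagawa defect (JNT 2009, Thm. B) is `p > 3` and split multiplicative; Kim 2025 §7
states it as Conjectures 7.1 / 7.4; in analytic rank ZERO at a good `3` gen 18 DERIVED it from Wuthrich's
Prop. 21 (`GoodThree.kimTamagawaDefectGeAt_of_kim2025_OPEN_of_wuthrich`), but Prop. 21 is void in rank one).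
So these are DOUBLY CONDITIONAL readings; their use is to NAME, per pair, exactly what the O3 / O4@3
TAM-DEFECT rows wait for.

## Why

iw-2's ENGINE K v1.3 depth-`k` production (GEN 12; `HOME/b2b-bsdres-iw-2/ENGINE-K-P9.md` §4) reads, on the
rank-one populations R1k2 (`v₃∏c + v₃#Ш_an = 1`, `q = 9`) and R1k3 (`= 2`, `q = 27`), `min ord₃ δ̃_ℓ = t`
EXACTLY at a cyclic `ℓ ∈ 𝒫_k` on 123/123 resp. 1 666/1 687 decided rows (0 below expectation) — Conjecture
1.10's prediction. Kim's rank-one clause turns such a number into `ord₃ #Ш(3) + ∂^{(∞)} ≤ k − 1`; on a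
`#Ш_an`-unit row with `t = 2` (O4@3: 96 open cells; O3: the bulk of its 51 open unit ∧ `3 ∣ ∏c` cells) and
`k = 3` this is `ord₃ #Ш(3) ≤ 2 − ∂^{(∞)}`, which closes the pair ONLY with `∂^{(∞)} ≥ t` — the missing
input this file displays as `hGe` (gen 22's `RankOneKimLevelKUnitRecordShape` needs `k ≤ 2`, i.e. `t ≤ 1`
plus Cassels–Tate, and says nothing at `t = 2`).

## What

* §1 (any `p ≥ 3`, any reduction at `p`, tower) `RankOne.padicValNat_sha_add_tamagawa_le_of_kim2025_OPEN_of_kimTamagawaDefectGeAt_of_kuriharaNumber_ne_zero`: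
  `ord_p #Ш(E/ℚ)(p) + ord_p ∏c ≤ k − 1` — n1011-p11's (LK-3) with `L(E,1) = 0` from `r_an = 1` (`hmod`),
  `Ш` finite from GZK (`hGZK`), `Ω⁺_f`-integrality from the tower (n1011-p09); then
  `RankOne.card_sha_eq_one_of_kim2025_OPEN_of_kimTamagawaDefectGeAt_of_casselsTate_of_kuriharaNumber_ne_zero`:
  a level `k ≤ ord_p ∏c + 2` gives `#Ш(E/ℚ)(p) = 1` (by Cassels–Tate squareness `hCT`; at `k = t + 1` n1011-p11's
  (LK-4) does it without), and `RankOne.bsdp_iff_padicValRat_eq_zero_of_kim2025_OPEN_of_kimTamagawaDefectGeAt_of_kuriharaNumber_ne_zero`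
  (`BSD(E,p) ⟺ ord_p #Ш_an = 0`).
* §2 (`p = 3`, classes) `X8RankOne/X7RankOne.bsdp_three_of_kim2025_OPEN_of_kimTamagawaDefectGeAt_of_kuriharaNumber_ne_zero_of_surj`
  (tower from surj(3) alone, gen 21) and the literal-equation RECORD SHAPES
  `X8RankOne/X7RankOne.bsdp_three_of_kim2025_OPEN_of_kimTamagawaDefectGeAt_of_ainvs_of_kuriharaNumber_ne_zero_of_shaAn_unit`
  (minimality explicit, class from the count at `3` (+ additive prime for X7), `ℓ ∈ 𝒫_k` from
  `countPointsFast`, cube-test cyclicity; binders `hK25s`, `hGe`, `hCT`, `hGZK`, `hmod`, `D`, `hsurj`,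
  `ht : ord₃ ∏c = t` (Cremona datum; `W.tamagawaProduct` is not computed here), `k ≤ t + 2`, `hδ`,
  `#Ш_an = q`, `ord₃ q = 0`).

NOT claimed: no class theorem; neither binder is asserted; no certificate is asserted to exist; the
rank-one `≥` half of Conjecture 1.10 at `p = 3` is NOT in print (see above) — these rows stay on gen 20's
rem13 records (tier-D `hK`) for any booking purpose.

References: [Kim2025RefinedTNC] Thm. 1.1, §7 Conj. 7.1/7.4, §8.1.2 (ANNOUNCED, OPEN binder);
[Kim2022StructureSelmer] Thm. 1.9 (6), §1.5.1, Conj. 1.10, Rem. 6.2; [Buyukboduk2009TamagawaDefect] Thm. B,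
Question 1; [SilvermanAEC2009] X.4.14; [Wuthrich2014] Lemma 20, Prop. 21; [Miller2011LMS] Def. 1.1.
-/

set_option autoImplicit false

noncomputable section

open scoped Classical MatrixGroups ModularForm

open CongruenceSubgroup WeierstrassCurve Literature.NumberTheory.EllipticCurves
  Literature.NumberTheory.EllipticCurves.ModularForms
  Literature.NumberTheory.EllipticCurves.Rank1Residual
  Literature.NumberTheory.EllipticCurves.Rank1Residual.Typed
  Literature.NumberTheory.EllipticCurves.Rank1Residual.X11RankOneCertificates
  Summit.BirchSwinnertonDyer.BirchSwinnertonDyer.Rank1Residual.IntModel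
  Summit.BirchSwinnertonDyer.BirchSwinnertonDyer.Rank1Residual.X11RankOne
  Summit.BirchSwinnertonDyer.Rank1Residual.X11b
  Summit.BirchSwinnertonDyer.Rank1Residual.Additive

namespace Summit.BirchSwinnertonDyer.Rank1Residual.Supersingular

/-! ### §1 Any `p ≥ 3`, any reduction at `p`, under the tower: the TAM-DEFECT level-`k` shape -/

section AnyP

variable (W : WeierstrassCurve ℚ) [W.IsElliptic] [W.IsGloballyMinimal] (p : ℕ) [hp : Fact p.Prime]

/-- **`ord_p #Ш(E/ℚ)(p) + ord_p ∏c_ℓ ≤ k − 1` from ONE level-`p^k` prime Kurihara number, MODULO Kim 2025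
(PRE) AND Conjecture 1.10's `≥` half at the pair** (`p ≥ 3`, tower, `r_an = 1`): n1011-p11's own-currency
`rankOne_sha_val_add_tamagawa_le_of_thm11_of_levelK` (LK-3) with `L(E,1) = 0` from `hmod`, `Ш` finite
from `hGZK`, and the `Ω⁺_f`-integrality from the tower (`forall_padicValRat_ratPlusSymbol_nonneg_of_towerSurj`).
DOUBLY CONDITIONAL (`hK25s` PRE, `hGe` CONJECTURE). Per pair. [claim: Kim2025RefinedTNC, status: under-review]
[cite: Kim2025RefinedTNC, Thm. 1.1 ("BSD") (ANNOUNCED, OPEN binder)] [cite: Kim2022StructureSelmer, Thm. 1.9 (6) and Conj. 1.10 (PDF p. 8)] -/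
theorem RankOne.padicValNat_sha_add_tamagawa_le_of_kim2025_OPEN_of_kimTamagawaDefectGeAt_of_kuriharaNumber_ne_zero
    (hK25s : Kim2025.thm11_kimShaLength_of_integralPeriod_OPEN)
    (hGZK : rank_eq_analyticRank_of_analyticRank_le_one) (hmod : hasEntireLFunction_rat)
    (hp3 : 3 ≤ p) (hr : W.analyticRank = 1) (htower : ∀ n : ℕ, W.HasSurjectiveModNGaloisRep (p ^ n : ℕ))
    {N : ℕ} [NeZero N] (D : ModularParametrizationData W N) (hGe : X4.KimTamagawaDefectGeAt W p D.f)
    {k : ℕ} (hk : 1 ≤ k) (ℓ : ℕ) [Fact ℓ.Prime] (hℓ : Kato.IsKolyvaginPrime W p k ℓ)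
    (hcyc : Nat.card {P : ((WeierstrassCurve.integralModelInt W).map
        (Int.castRingHom (ZMod ℓ))).toAffine.Point // p • P = 0} ≤ p)
    (ψ : (ℓ' : ℕ) → (ZMod ℓ')ˣ →* Multiplicative (ZMod (p ^ k)))
    (hψ : Function.Surjective (ψ ℓ)) (hδ : kuriharaNumber D.f (p ^ k) ℓ ψ ≠ 0) :
    padicValNat p (Nat.card (AddCommGroup.primaryComponent W.sha p)) +
      padicValNat p W.tamagawaProduct ≤ k - 1 := by
  have hp2 : p ≠ 2 := by omega
  have hL : W.entireLFunction 1 = 0 := by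
    by_contra hL
    have h0 := (W.analyticRank_eq_zero_iff_holds (hmod W)).mpr hL
    omega
  have hfin : Finite W.sha := (hGZK W (by rw [hr])).2
  exact rankOne_sha_val_add_tamagawa_le_of_thm11_of_levelK W p hK25s hp3 htower hL hfin D.isNewformOf
    (forall_padicValRat_ratPlusSymbol_nonneg_of_towerSurj hp2 D.isNewformOf htower) hGe hk ℓ hℓ hcyc ψ hψ hδ

/-- **`#Ш(E/ℚ)(p) = 1` on a TAM-DEFECT row from ONE level-`p^k` prime number with `k ≤ ord_p ∏c + 2`**,
MODULO Kim 2025 AND Conjecture 1.10's `≥` half at the pair: §1 gives `ord_p #Ш(p) ≤ k − 1 − ord_p ∏c ≤ 1`,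
Cassels–Tate squareness (`hCT`, PUBLISHED) makes it `0` (at the exact level `k = ord_p ∏c + 1` squareness is
not even needed — n1011-p11's (LK-4)). DOUBLY CONDITIONAL. Per pair. [claim: Kim2025RefinedTNC, status: under-review]
[cite: Kim2025RefinedTNC, Thm. 1.1 ("BSD") (ANNOUNCED, OPEN binder)] [cite: Kim2022StructureSelmer, Thm. 1.9 (6) and Conj. 1.10 (PDF p. 8)]
[cite: SilvermanAEC2009, Thm. X.4.14] -/
theorem RankOne.card_sha_eq_one_of_kim2025_OPEN_of_kimTamagawaDefectGeAt_of_casselsTate_of_kuriharaNumber_ne_zero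
    (hK25s : Kim2025.thm11_kimShaLength_of_integralPeriod_OPEN)
    (hCT : exists_casselsTate_pairing (K := ℚ))
    (hGZK : rank_eq_analyticRank_of_analyticRank_le_one) (hmod : hasEntireLFunction_rat)
    (hp3 : 3 ≤ p) (hr : W.analyticRank = 1) (htower : ∀ n : ℕ, W.HasSurjectiveModNGaloisRep (p ^ n : ℕ))
    {N : ℕ} [NeZero N] (D : ModularParametrizationData W N) (hGe : X4.KimTamagawaDefectGeAt W p D.f)
    {k : ℕ} (hk : 1 ≤ k) (hkt : k ≤ padicValNat p W.tamagawaProduct + 2)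
    (ℓ : ℕ) [Fact ℓ.Prime] (hℓ : Kato.IsKolyvaginPrime W p k ℓ)
    (hcyc : Nat.card {P : ((WeierstrassCurve.integralModelInt W).map
        (Int.castRingHom (ZMod ℓ))).toAffine.Point // p • P = 0} ≤ p)
    (ψ : (ℓ' : ℕ) → (ZMod ℓ')ˣ →* Multiplicative (ZMod (p ^ k)))
    (hψ : Function.Surjective (ψ ℓ)) (hδ : kuriharaNumber D.f (p ^ k) ℓ ψ ≠ 0) :
    Nat.card (AddCommGroup.primaryComponent W.sha p) = 1 := by
  have hfin : Finite W.sha := (hGZK W (by rw [hr])).2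
  haveI : Finite W.sha := hfin
  have hle := RankOne.padicValNat_sha_add_tamagawa_le_of_kim2025_OPEN_of_kimTamagawaDefectGeAt_of_kuriharaNumber_ne_zero
    W p hK25s hGZK hmod hp3 hr htower D hGe hk ℓ hℓ hcyc ψ hψ hδ
  have h0 : padicValNat p W.shaOrder = 2 * 0 :=
    padicValNat_shaOrder_eq_of_casselsTate_of_pow_dvd_of_le W p hCT hfin (j := 0) (by simp) (by omega)
  have hcard : padicValNat p (Nat.card (AddCommGroup.primaryComponent W.sha p)) =
      padicValNat p W.shaOrder := by
    unfold WeierstrassCurve.shaOrder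
    exact padicValNat_card_addPrimaryComponent p
  exact card_primaryComponent_eq_one_of_padicValNat_eq_zero W p (by rw [hcard, h0])

/-- **`BSD(E,p) ⟺ ord_p #Ш_an = 0` on a TAM-DEFECT row in analytic rank one**, given ONE level-`p^k` prime
Kurihara number with `k ≤ ord_p ∏c + 2`, MODULO Kim 2025 AND Conjecture 1.10's `≥` half at the pair (from
`#Ш(E/ℚ)(p) = 1` and `X4.bsdp_iff_padicValRat_eq_zero_of_card_primaryComponent_eq_one`). DOUBLY CONDITIONAL;
`hCT`/`hGZK`/`hmod` PUBLISHED. Per pair. [claim: Kim2025RefinedTNC, status: under-review]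
[cite: Kim2025RefinedTNC, Thm. 1.1 ("BSD") (ANNOUNCED, OPEN binder)] [cite: Kim2022StructureSelmer, Conj. 1.10 (PDF p. 8)]
[cite: SilvermanAEC2009, Thm. X.4.14] [cite: Miller2011LMS, Def. 1.1] -/
theorem RankOne.bsdp_iff_padicValRat_eq_zero_of_kim2025_OPEN_of_kimTamagawaDefectGeAt_of_kuriharaNumber_ne_zero
    (hK25s : Kim2025.thm11_kimShaLength_of_integralPeriod_OPEN)
    (hCT : exists_casselsTate_pairing (K := ℚ))
    (hGZK : rank_eq_analyticRank_of_analyticRank_le_one) (hmod : hasEntireLFunction_rat)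
    (hp3 : 3 ≤ p) (hr : W.analyticRank = 1) (htower : ∀ n : ℕ, W.HasSurjectiveModNGaloisRep (p ^ n : ℕ))
    {N : ℕ} [NeZero N] (D : ModularParametrizationData W N) (hGe : X4.KimTamagawaDefectGeAt W p D.f)
    {k : ℕ} (hk : 1 ≤ k) (hkt : k ≤ padicValNat p W.tamagawaProduct + 2)
    (ℓ : ℕ) [Fact ℓ.Prime] (hℓ : Kato.IsKolyvaginPrime W p k ℓ)
    (hcyc : Nat.card {P : ((WeierstrassCurve.integralModelInt W).map
        (Int.castRingHom (ZMod ℓ))).toAffine.Point // p • P = 0} ≤ p)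
    (ψ : (ℓ' : ℕ) → (ZMod ℓ')ˣ →* Multiplicative (ZMod (p ^ k)))
    (hψ : Function.Surjective (ψ ℓ)) (hδ : kuriharaNumber D.f (p ^ k) ℓ ψ ≠ 0)
    {q : ℚ} (hq : shaAn W = (q : ℂ)) : BSDp W p ↔ padicValRat p q = 0 := by
  obtain ⟨hmw, hfin⟩ := hGZK W (by rw [hr])
  exact X4.bsdp_iff_padicValRat_eq_zero_of_card_primaryComponent_eq_one W p hmw hfin
    (RankOne.card_sha_eq_one_of_kim2025_OPEN_of_kimTamagawaDefectGeAt_of_casselsTate_of_kuriharaNumber_ne_zero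
      W p hK25s hCT hGZK hmod hp3 hr htower D hGe hk hkt ℓ hℓ hcyc ψ hψ hδ) hq

end AnyP

/-! ### §2 `p = 3`: classes X8 (O3) and X7 (O4@3), tower from surj(3) alone; literal-equation RECORD SHAPES -/

section Three

variable (W : WeierstrassCurve ℚ) [W.IsElliptic] [W.IsGloballyMinimal]

/-- **O3 TAM-DEFECT rows (X8 ∧ `r_an = 1` ∧ surj(3) ∧ `#Ш_an` unit ∧ `3 ∣ ∏c`)**: `BSD(E,3)` from ONE
level-`3^k` prime Kurihara number, `k ≤ ord₃ ∏c + 2`, MODULO Kim 2025 AND Conj. 1.10's `≥` half at the pair;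
tower by `ClassX8.towerSurj_of_surj`. DOUBLY CONDITIONAL. Per pair; NOT a class theorem.
[claim: Kim2025RefinedTNC, status: under-review] [cite: Kim2025RefinedTNC, Thm. 1.1 (ANNOUNCED, OPEN binder)]
[cite: Kim2022StructureSelmer, Conj. 1.10 (PDF p. 8)] [cite: SilvermanAEC2009, Thm. X.4.14] [cite: Wuthrich2014, Lemma 20 (p. 399)]
[cite: Miller2011LMS, §1 and Def. 1.1] -/
theorem X8RankOne.bsdp_three_of_kim2025_OPEN_of_kimTamagawaDefectGeAt_of_kuriharaNumber_ne_zero_of_surj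
    (hK25s : Kim2025.thm11_kimShaLength_of_integralPeriod_OPEN)
    (hCT : exists_casselsTate_pairing (K := ℚ))
    (hGZK : rank_eq_analyticRank_of_analyticRank_le_one) (hmod : hasEntireLFunction_rat)
    (hr : W.analyticRank = 1) (hX : ClassX8 W 3) (hs : Surj W 3)
    {N : ℕ} [NeZero N] (D : ModularParametrizationData W N) (hGe : X4.KimTamagawaDefectGeAt W 3 D.f)
    {k : ℕ} (hk : 1 ≤ k) (hkt : k ≤ padicValNat 3 W.tamagawaProduct + 2)
    (ℓ : ℕ) [Fact ℓ.Prime] (hℓ : Kato.IsKolyvaginPrime W 3 k ℓ)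
    (hcyc : Nat.card {P : ((WeierstrassCurve.integralModelInt W).map
        (Int.castRingHom (ZMod ℓ))).toAffine.Point // 3 • P = 0} ≤ 3)
    (ψ : (ℓ'' : ℕ) → (ZMod ℓ'')ˣ →* Multiplicative (ZMod (3 ^ k)))
    (hψ : Function.Surjective (ψ ℓ)) (hδ : kuriharaNumber D.f (3 ^ k) ℓ ψ ≠ 0)
    {q : ℚ} (hq : shaAn W = (q : ℂ)) (hv : padicValRat 3 q = 0) : BSDp W 3 :=
  haveI : Fact (Nat.Prime 3) := ⟨by norm_num⟩
  (RankOne.bsdp_iff_padicValRat_eq_zero_of_kim2025_OPEN_of_kimTamagawaDefectGeAt_of_kuriharaNumber_ne_zero W 3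
    hK25s hCT hGZK hmod le_rfl hr (ClassX8.towerSurj_of_surj W 3 hX hs) D hGe hk hkt ℓ hℓ hcyc ψ hψ hδ hq).mpr hv

/-- **O4@3 TAM-DEFECT rows (X7@3 ∧ `r_an = 1` ∧ surj(3) ∧ `#Ш_an` unit ∧ `3 ∣ ∏c`)** — the X7 twin
(tower by `ClassX7.towerSurj_of_surj`). DOUBLY CONDITIONAL; X7 joint pair, B side. Per pair.
[claim: Kim2025RefinedTNC, status: under-review] [cite: Kim2025RefinedTNC, Thm. 1.1 (ANNOUNCED, OPEN binder)]
[cite: Kim2022StructureSelmer, Conj. 1.10 (PDF p. 8)] [cite: SilvermanAEC2009, Thm. X.4.14] [cite: Wuthrich2014, Lemma 20 (p. 399)]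
[cite: Miller2011LMS, §1 and Def. 1.1] -/
theorem X7RankOne.bsdp_three_of_kim2025_OPEN_of_kimTamagawaDefectGeAt_of_kuriharaNumber_ne_zero_of_surj
    (hK25s : Kim2025.thm11_kimShaLength_of_integralPeriod_OPEN)
    (hCT : exists_casselsTate_pairing (K := ℚ))
    (hGZK : rank_eq_analyticRank_of_analyticRank_le_one) (hmod : hasEntireLFunction_rat)
    (hr : W.analyticRank = 1) (hX : ClassX7 W 3) (hs : Surj W 3)
    {N : ℕ} [NeZero N] (D : ModularParametrizationData W N) (hGe : X4.KimTamagawaDefectGeAt W 3 D.f)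
    {k : ℕ} (hk : 1 ≤ k) (hkt : k ≤ padicValNat 3 W.tamagawaProduct + 2)
    (ℓ : ℕ) [Fact ℓ.Prime] (hℓ : Kato.IsKolyvaginPrime W 3 k ℓ)
    (hcyc : Nat.card {P : ((WeierstrassCurve.integralModelInt W).map
        (Int.castRingHom (ZMod ℓ))).toAffine.Point // 3 • P = 0} ≤ 3)
    (ψ : (ℓ'' : ℕ) → (ZMod ℓ'')ˣ →* Multiplicative (ZMod (3 ^ k)))
    (hψ : Function.Surjective (ψ ℓ)) (hδ : kuriharaNumber D.f (3 ^ k) ℓ ψ ≠ 0)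
    {q : ℚ} (hq : shaAn W = (q : ℂ)) (hv : padicValRat 3 q = 0) : BSDp W 3 :=
  haveI : Fact (Nat.Prime 3) := ⟨by norm_num⟩
  (RankOne.bsdp_iff_padicValRat_eq_zero_of_kim2025_OPEN_of_kimTamagawaDefectGeAt_of_kuriharaNumber_ne_zero W 3
    hK25s hCT hGZK hmod le_rfl hr (ClassX7.towerSurj_of_surj W 3 (by decide) hX hs) D hGe hk hkt ℓ hℓ hcyc ψ hψ
    hδ hq).mpr hv

end Three

/-! ### §3 Literal integer equations `[a₁, a₂, a₃, a₄, a₆]` — RECORD SHAPES (count by `countPointsFast`) -/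

section Literal

/-- **RECORD SHAPE, O3 TAM-DEFECT (X8, `#Ш_an` unit, `ord₃ ∏c = t`, prime level `ℓ ∈ 𝒫_k`, `k ≤ t + 2`).**
For an integer equation `[a₁,…,a₆]`: `hmin` (explicit), `3 ∤ Δ`, `countPoints [a] 3 ∈ {1,7}` (class X8); a prime
`ℓ ≥ 5`, `ℓ ∤ Δ`, `ℓ ≡ 1 (mod 3^k)`, `countPointsFast [a] ℓ = n_ℓ`, `3^k ∣ n_ℓ`, and the CUBE TEST — ALL
kernel-decidable; binders: `hsurj` (gen 21's certificate), `r_an = 1`, `D`, `hGe` (Conj. 1.10 `≥` at the pair,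
OPEN), `ht : ord₃ ∏c = t` (Cremona datum), `k ≤ t + 2`, a `ψ` surjective at `ℓ` with `kuriharaNumber D.f (3^k) ℓ ψ ≠ 0`
(engine datum), `#Ш_an = q` with `ord₃ q = 0` ⇒ **`BSD(E,3)`**. DOUBLY CONDITIONAL (`hK25s` PRE, `hGe` CONJECTURE);
`hCT`/`hGZK`/`hmod` PUBLISHED. Per pair; NOT a class theorem; nothing booked. [claim: Kim2025RefinedTNC, status: under-review]
[cite: Kim2025RefinedTNC, Thm. 1.1 (ANNOUNCED, OPEN binder)] [cite: Kim2022StructureSelmer, §1.2.2 and Conj. 1.10]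
[cite: SilvermanAEC2009, III.1, VII.1 Remark 1.1, VII.5 Prop. 5.1(a), Thm. X.4.14] [cite: IrelandRosen1990, Prop. 5.1.2 and §8.1]
[cite: Miller2011LMS, §1 and Def. 1.1] -/
theorem X8RankOne.bsdp_three_of_kim2025_OPEN_of_kimTamagawaDefectGeAt_of_ainvs_of_kuriharaNumber_ne_zero_of_shaAn_unit
    (hK25s : Kim2025.thm11_kimShaLength_of_integralPeriod_OPEN)
    (hCT : exists_casselsTate_pairing (K := ℚ))
    (hGZK : rank_eq_analyticRank_of_analyticRank_le_one) (hmod : hasEntireLFunction_rat)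
    (a1 a2 a3 a4 a6 : ℤ) (hmin : (⟨a1, a2, a3, a4, a6⟩ : WeierstrassCurve ℚ).IsGloballyMinimal)
    (h3Δ : ¬ (3 : ℤ) ∣ discOf [a1, a2, a3, a4, a6]) {n₃ : ℕ}
    (hc₃ : countPoints [a1, a2, a3, a4, a6] 3 = n₃) (hn17 : n₃ = 1 ∨ n₃ = 7)
    (hsurj : Surj (⟨a1, a2, a3, a4, a6⟩ : WeierstrassCurve ℚ) 3)
    (hr : (⟨a1, a2, a3, a4, a6⟩ : WeierstrassCurve ℚ).analyticRank = 1)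
    {N : ℕ} [NeZero N] (D : ModularParametrizationData (⟨a1, a2, a3, a4, a6⟩ : WeierstrassCurve ℚ) N)
    (hGe : X4.KimTamagawaDefectGeAt (⟨a1, a2, a3, a4, a6⟩ : WeierstrassCurve ℚ) 3 D.f)
    {t : ℕ} (ht : padicValNat 3 (⟨a1, a2, a3, a4, a6⟩ : WeierstrassCurve ℚ).tamagawaProduct = t)
    {k : ℕ} (hk : 1 ≤ k) (hkt : k ≤ t + 2) (ℓ : ℕ) [hℓ : Fact ℓ.Prime] (h5 : 5 ≤ ℓ)
    (hℓΔ : ¬ (ℓ : ℤ) ∣ discOf [a1, a2, a3, a4, a6]) (h1 : ℓ ≡ 1 [MOD 3 ^ k]) {nℓ : ℕ}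
    (hnℓ : countPointsFast [a1, a2, a3, a4, a6] ℓ = nℓ) (hdvd : 3 ^ k ∣ nℓ)
    (hΔ0 : ((discOf [a1, a2, a3, a4, a6] : ℤ) : ZMod ℓ) ≠ 0)
    (hχ : ((discOf [a1, a2, a3, a4, a6] : ℤ) : ZMod ℓ) ^ ((ℓ - 1) / 3) ≠ 1)
    (ψ : (ℓ'' : ℕ) → (ZMod ℓ'')ˣ →* Multiplicative (ZMod (3 ^ k)))
    (hψ : Function.Surjective (ψ ℓ))
    (hδ : kuriharaNumber D.f (3 ^ k) ℓ ψ ≠ 0)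
    {q : ℚ} (hq : shaAn (⟨a1, a2, a3, a4, a6⟩ : WeierstrassCurve ℚ) = (q : ℂ)) (hv : padicValRat 3 q = 0) :
    BSDp (⟨a1, a2, a3, a4, a6⟩ : WeierstrassCurve ℚ) 3 := by
  have h0 : discOf [a1, a2, a3, a4, a6] ≠ 0 := fun h ↦ h3Δ (by rw [h]; exact dvd_zero _)
  haveI := isElliptic_of_discOf_ne_zero a1 a2 a3 a4 a6 h0
  haveI := hmin
  haveI : Fact (Nat.Prime 3) := ⟨by norm_num⟩
  have hI : integralModelInt (⟨a1, a2, a3, a4, a6⟩ : WeierstrassCurve ℚ) = ⟨a1, a2, a3, a4, a6⟩ :=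
    integralModelInt_eq_of_map_eq _ (map_mk_int a1 a2 a3 a4 a6)
  have hΔℓ : ((⟨a1, a2, a3, a4, a6⟩ : WeierstrassCurve ℤ).map (Int.castRingHom (ZMod ℓ))).Δ =
      ((discOf [a1, a2, a3, a4, a6] : ℤ) : ZMod ℓ) := by
    rw [WeierstrassCurve.map_Δ, intCurve_Δ, eq_intCast]
  have hX : ClassX8 (⟨a1, a2, a3, a4, a6⟩ : WeierstrassCurve ℚ) 3 :=
    classX8_of_intModel hI (by rw [intCurve_Δ]; exact h3Δ)
      (natCard_point_eq_of_countPoints a1 a2 a3 a4 a6 3 (by decide) h3Δ hc₃) hn17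
  have hnℓ' := natCard_point_eq_of_countPoints a1 a2 a3 a4 a6 ℓ (by omega) hℓΔ (countPoints_eq_of_fast hnℓ)
  exact X8RankOne.bsdp_three_of_kim2025_OPEN_of_kimTamagawaDefectGeAt_of_kuriharaNumber_ne_zero_of_surj _ hK25s
    hCT hGZK hmod hr hX hsurj D hGe hk (by rw [ht]; exact hkt) ℓ
    (isKolyvaginPrime_of_intModel_of_card hI 3 k ℓ (by omega) (by rw [intCurve_Δ]; exact hℓΔ) h1 hnℓ' hdvd)
    (card_three_torsion_le_of_intModel_of_pow_div_three_ne_one hI ℓ (by rw [hΔℓ]; exact hΔ0) (by rw [hΔℓ]; exact hχ) h5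
      (three_dvd_sub_one_of_modEq_pow hk h1)) ψ hψ hδ hq hv

/-- **RECORD SHAPE, O4@3 TAM-DEFECT (X7 at `3`, `#Ш_an` unit, `ord₃ ∏c = t`, prime level `ℓ ∈ 𝒫_k`, `k ≤ t + 2`)**
— the X7 twin: class X7 from `3 ∤ Δ`, `countPoints [a] 3 = n₃` with `3 ∣ 3 + 1 − n₃` and an ADDITIVE prime `q'`
(`q' ∣ Δ`, `q' ∣ c₄`); everything else as the X8 shape. DOUBLY CONDITIONAL (`hK25s` PRE, `hGe` CONJECTURE); X7
joint pair, B side. Per pair; NOT a class theorem; nothing booked. [claim: Kim2025RefinedTNC, status: under-review]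
[cite: Kim2025RefinedTNC, Thm. 1.1 (ANNOUNCED, OPEN binder)] [cite: Kim2022StructureSelmer, §1.2.2 and Conj. 1.10]
[cite: SilvermanAEC2009, III.1, VII.1 Remark 1.1, VII.5 Prop. 5.1(a) and (c), Thm. X.4.14]
[cite: IrelandRosen1990, Prop. 5.1.2 and §8.1] [cite: Miller2011LMS, §1 and Def. 1.1] -/
theorem X7RankOne.bsdp_three_of_kim2025_OPEN_of_kimTamagawaDefectGeAt_of_ainvs_of_kuriharaNumber_ne_zero_of_shaAn_unit
    (hK25s : Kim2025.thm11_kimShaLength_of_integralPeriod_OPEN)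
    (hCT : exists_casselsTate_pairing (K := ℚ))
    (hGZK : rank_eq_analyticRank_of_analyticRank_le_one) (hmod : hasEntireLFunction_rat)
    (a1 a2 a3 a4 a6 : ℤ) (hmin : (⟨a1, a2, a3, a4, a6⟩ : WeierstrassCurve ℚ).IsGloballyMinimal)
    (h3Δ : ¬ (3 : ℤ) ∣ discOf [a1, a2, a3, a4, a6]) {n₃ : ℕ}
    (hc₃ : countPoints [a1, a2, a3, a4, a6] 3 = n₃) (ha₃ : (3 : ℤ) ∣ (3 : ℤ) + 1 - n₃)
    (q' : ℕ) (hq' : q'.Prime) (hqΔ : (q' : ℤ) ∣ discOf [a1, a2, a3, a4, a6])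
    (hqc₄ : (q' : ℤ) ∣ c4Of [a1, a2, a3, a4, a6])
    (hsurj : Surj (⟨a1, a2, a3, a4, a6⟩ : WeierstrassCurve ℚ) 3)
    (hr : (⟨a1, a2, a3, a4, a6⟩ : WeierstrassCurve ℚ).analyticRank = 1)
    {N : ℕ} [NeZero N] (D : ModularParametrizationData (⟨a1, a2, a3, a4, a6⟩ : WeierstrassCurve ℚ) N)
    (hGe : X4.KimTamagawaDefectGeAt (⟨a1, a2, a3, a4, a6⟩ : WeierstrassCurve ℚ) 3 D.f)
    {t : ℕ} (ht : padicValNat 3 (⟨a1, a2, a3, a4, a6⟩ : WeierstrassCurve ℚ).tamagawaProduct = t)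
    {k : ℕ} (hk : 1 ≤ k) (hkt : k ≤ t + 2) (ℓ : ℕ) [hℓ : Fact ℓ.Prime] (h5 : 5 ≤ ℓ)
    (hℓΔ : ¬ (ℓ : ℤ) ∣ discOf [a1, a2, a3, a4, a6]) (h1 : ℓ ≡ 1 [MOD 3 ^ k]) {nℓ : ℕ}
    (hnℓ : countPointsFast [a1, a2, a3, a4, a6] ℓ = nℓ) (hdvd : 3 ^ k ∣ nℓ)
    (hΔ0 : ((discOf [a1, a2, a3, a4, a6] : ℤ) : ZMod ℓ) ≠ 0)
    (hχ : ((discOf [a1, a2, a3, a4, a6] : ℤ) : ZMod ℓ) ^ ((ℓ - 1) / 3) ≠ 1)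
    (ψ : (ℓ'' : ℕ) → (ZMod ℓ'')ˣ →* Multiplicative (ZMod (3 ^ k)))
    (hψ : Function.Surjective (ψ ℓ))
    (hδ : kuriharaNumber D.f (3 ^ k) ℓ ψ ≠ 0)
    {q : ℚ} (hq : shaAn (⟨a1, a2, a3, a4, a6⟩ : WeierstrassCurve ℚ) = (q : ℂ)) (hv : padicValRat 3 q = 0) :
    BSDp (⟨a1, a2, a3, a4, a6⟩ : WeierstrassCurve ℚ) 3 := by
  have h0 : discOf [a1, a2, a3, a4, a6] ≠ 0 := fun h ↦ h3Δ (by rw [h]; exact dvd_zero _)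
  haveI := isElliptic_of_discOf_ne_zero a1 a2 a3 a4 a6 h0
  haveI := hmin
  haveI : Fact (Nat.Prime 3) := ⟨by norm_num⟩
  have hI : integralModelInt (⟨a1, a2, a3, a4, a6⟩ : WeierstrassCurve ℚ) = ⟨a1, a2, a3, a4, a6⟩ :=
    integralModelInt_eq_of_map_eq _ (map_mk_int a1 a2 a3 a4 a6)
  have hΔℓ : ((⟨a1, a2, a3, a4, a6⟩ : WeierstrassCurve ℤ).map (Int.castRingHom (ZMod ℓ))).Δ =
      ((discOf [a1, a2, a3, a4, a6] : ℤ) : ZMod ℓ) := by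
    rw [WeierstrassCurve.map_Δ, intCurve_Δ, eq_intCast]
  have hX : ClassX7 (⟨a1, a2, a3, a4, a6⟩ : WeierstrassCurve ℚ) 3 :=
    classX7_of_intModel (p := 3) hI (by rw [intCurve_Δ]; exact h3Δ)
      (natCard_point_eq_of_countPoints a1 a2 a3 a4 a6 3 (by decide) h3Δ hc₃) ha₃ q' hq'
      (by rw [intCurve_Δ]; exact hqΔ) (by rw [intCurve_c₄]; exact hqc₄)
  have hnℓ' := natCard_point_eq_of_countPoints a1 a2 a3 a4 a6 ℓ (by omega) hℓΔ (countPoints_eq_of_fast hnℓ)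
  exact X7RankOne.bsdp_three_of_kim2025_OPEN_of_kimTamagawaDefectGeAt_of_kuriharaNumber_ne_zero_of_surj _ hK25s
    hCT hGZK hmod hr hX hsurj D hGe hk (by rw [ht]; exact hkt) ℓ
    (isKolyvaginPrime_of_intModel_of_card hI 3 k ℓ (by omega) (by rw [intCurve_Δ]; exact hℓΔ) h1 hnℓ' hdvd)
    (card_three_torsion_le_of_intModel_of_pow_div_three_ne_one hI ℓ (by rw [hΔℓ]; exact hΔ0) (by rw [hΔℓ]; exact hχ) h5
      (three_dvd_sub_one_of_modEq_pow hk h1)) ψ hψ hδ hq hv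

end Literal

end Summit.BirchSwinnertonDyer.Rank1Residual.Supersingular

end
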